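import Literature.Barriers.CriticalPhenomena.RigorousRGSmallParameterDiscreteBump
import Mathlib.Data.ZMod.ValMinAbs
import HarnessLib

/-!
# `RigorousRGSmallParameter` (Slade, Theorem 1.4.1): the discrete bump on `ZMod M` through the
# centred coordinate, and mixed forward/backward differences ([BS-rg-loc] §3.3, cutoff `χ_t`)

Companion ("proof architecture") file of
`Literature/Barriers/CriticalPhenomena/RigorousRGSmallParameter.lean` (Loc norm-estimates layer,
[BS-rg-loc] §3.3: "Lemmas (lem:gX)–(lem:phij) are in essence statements about test functions and
Taylor approximation on the infinite lattice `ℤ^d`, which we can apply to the torus `Λ` by judicious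
restriction to a coordinate patch. The correspondence between `ℤ^d` and a coordinate patch is
possible since norms of test functions are preserved by a coordinate `z` … since
nearest-neighbours and hence derivatives are preserved by `z`"). This file PROVES that transfer for
the one-dimensional bump of `…DiscreteBump`: lifted through the centred coordinate
`z(y) = (y - c).valMinAbs`, its lattice differences on `ZMod M` are the lifted differences as long
as the support stays `K` steps inside the window, and mixed `±` differences are signed shifted
forward differences, so `|D_l b| ≤ (2/w)^{|l|}` for `|l| ≤ K`. All PROVED, 0 sorry:

* `valMinAbs_add_one_of_le/_of_lt` (the coordinate steps by `+1`, wrapping by `-M` at the end),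
  `liftM`, `fwdDiffM`, `VanNear`, `vanNear_fwdDiff`, `vanNear_iter_fwdDiff`, `VanNear.mono`,
  **`fwdDiffM_liftM`** (`Δ(lift g) = lift(Δg)`), **`iter_fwdDiffM_liftM`**;
* `shiftM`, `fwdDiffM_shiftM`, `iter_fwdDiffM_shiftM`, `dirDiff`, `dirDiffs`, `dirDiff_false/_true`,
  **`dirDiffs_eq`** (`D_l = (-1)^{#back} τ_{-#back} Δ^{|l|}`), `abs_dirDiffs_le`;
* `bumpM`, `vanNear_bumpZ`, **`abs_dirDiffs_bumpM_le`**, `bumpM_mem_Icc`, `bumpM_eq_one`, `bumpM_eq_zero`.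

Sources: D. C. Brydges, G. Slade, *A renormalisation group method. II. Approximation by local
polynomials*, J. Stat. Phys. 159 (2015) 461–491, arXiv:1403.7253, §3.3 (the quoted paragraph and
the proof of Lemma 3.3.1), TeX-source numbering; the constructions are folklore.

## References

* [BrydgesSlade2015RGII] D. C. Brydges, G. Slade, *A renormalisation group method. II.
  Approximation by local polynomials*, J. Stat. Phys. **159** (2015) 461–491, arXiv:1403.7253.
-/

noncomputable section

namespace Literature.Barriers.CriticalPhenomena

namespace LongRangePhi4

namespace Bump

open Finset

variable {M : ℕ} [NeZero M]

/-- The centred coordinate steps by `+1` away from the right end of the window. [folklore] -/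
theorem valMinAbs_add_one_of_le (i : ZMod M) (h : (i.valMinAbs + 1) * 2 ≤ (M : ℤ)) :
    (i + 1).valMinAbs = i.valMinAbs + 1 := by
  have hi := i.valMinAbs_mem_Ioc
  rw [ZMod.valMinAbs_spec]
  exact ⟨by simp [ZMod.coe_valMinAbs], by linarith [hi.1], h⟩

/-- At the right end of the window the centred coordinate wraps by `-M`. [folklore] -/
theorem valMinAbs_add_one_of_lt (i : ZMod M) (h : (M : ℤ) < (i.valMinAbs + 1) * 2) :
    (i + 1).valMinAbs = i.valMinAbs + 1 - M := by
  have hi := i.valMinAbs_mem_Ioc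
  have h1 : (0 : ℤ) < M := by exact_mod_cast Nat.pos_of_ne_zero (NeZero.ne M)
  rw [ZMod.valMinAbs_spec]
  exact ⟨by simp [ZMod.coe_valMinAbs], by linarith, by linarith [hi.2]⟩

/-- Lift of a function on `ℤ` to `ZMod M` through the centred coordinate around `c`. [folklore] -/
def liftM (c : ZMod M) (g : ℤ → ℝ) : ZMod M → ℝ := fun y => g ((y - c).valMinAbs)

/-- Forward difference on `ZMod M`. [folklore] -/
def fwdDiffM (h : ZMod M → ℝ) : ZMod M → ℝ := fun y => h (y + 1) - h y

/-- `g` vanishes near the ends of the window: `g t = 0` whenever `T ≤ 2|t|`. [folklore] -/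
def VanNear (T : ℤ) (g : ℤ → ℝ) : Prop := ∀ t : ℤ, T ≤ 2 * |t| → g t = 0

omit [NeZero M] in
/-- One difference costs `2` in the vanishing threshold. [folklore] -/
theorem vanNear_fwdDiff {T : ℤ} {g : ℤ → ℝ} (h : VanNear T g) : VanNear (T + 2) (fwdDiff g) := by
  intro t ht
  simp only [Bump.fwdDiff]
  rw [h t (by linarith), h (t + 1) ?_, sub_zero]
  rcases abs_cases t with ⟨h1, _⟩ | ⟨h1, _⟩ <;> rcases abs_cases (t + 1) with ⟨h2, _⟩ | ⟨h2, _⟩ <;> linarith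

omit [NeZero M] in
/-- Iterated differences. [folklore] -/
theorem vanNear_iter_fwdDiff {T : ℤ} {g : ℤ → ℝ} (h : VanNear T g) : ∀ k : ℕ, VanNear (T + 2 * k) (fwdDiff^[k] g)
  | 0 => by simpa using h
  | k + 1 => by
      have := vanNear_fwdDiff (vanNear_iter_fwdDiff h k)
      rw [Function.iterate_succ_apply']
      convert this using 1
      push_cast; ring

omit [NeZero M] in
/-- Weakening the threshold. [folklore] -/
theorem VanNear.mono {T T' : ℤ} {g : ℤ → ℝ} (h : VanNear T g) (hT : T ≤ T') : VanNear T' g :=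
  fun t ht => h t (hT.trans ht)

/-- **The lift intertwines the differences** when `g` vanishes near the window ends (`T ≤ M - 2`):
`Δ(liftM g) = liftM(Δg)`. [folklore] -/
theorem fwdDiffM_liftM {T : ℤ} {g : ℤ → ℝ} (hg : VanNear T g) (hT : T ≤ (M : ℤ) - 2) (c : ZMod M) :
    fwdDiffM (liftM c g) = liftM c (fwdDiff g) := by
  funext y
  simp only [fwdDiffM, liftM, Bump.fwdDiff]
  have e : y + 1 - c = (y - c) + 1 := by ring
  rw [e]
  set i := y - c
  have hi := i.valMinAbs_mem_Ioc
  by_cases hc : (i.valMinAbs + 1) * 2 ≤ (M : ℤ)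
  · rw [valMinAbs_add_one_of_le i hc]
  · push Not at hc
    rw [valMinAbs_add_one_of_lt i hc]
    -- all three values vanish
    have h0 : g i.valMinAbs = 0 := hg _ (by rw [abs_of_nonneg (by linarith [hi.1])]; linarith)
    have h1 : g (i.valMinAbs + 1) = 0 := hg _ (by rw [abs_of_nonneg (by linarith [hi.1])]; linarith)
    have hM1 : (1 : ℤ) ≤ M := by exact_mod_cast Nat.one_le_iff_ne_zero.2 (NeZero.ne M)
    have hle : i.valMinAbs + 1 - M ≤ 0 := by have := hi.2; omega
    have h2 : g (i.valMinAbs + 1 - M) = 0 := hg _ (by rw [abs_of_nonpos hle]; linarith [hi.2])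
    rw [h0, h1, h2]

/-- Iterated version: `Δ^k(liftM g) = liftM(Δ^k g)` for `k ≤ K` when `g` vanishes for `2|t| ≥ M - 2K`. [folklore] -/
theorem iter_fwdDiffM_liftM {K : ℕ} {g : ℤ → ℝ} (hg : VanNear ((M : ℤ) - 2 * K) g) (c : ZMod M) :
    ∀ k, k ≤ K → fwdDiffM^[k] (liftM c g) = liftM c (fwdDiff^[k] g)
  | 0, _ => rfl
  | k + 1, hk => by
      rw [Function.iterate_succ_apply', iter_fwdDiffM_liftM hg c k (by omega), Function.iterate_succ_apply']
      refine fwdDiffM_liftM (vanNear_iter_fwdDiff hg k) ?_ c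
      have : (k : ℤ) + 1 ≤ K := by exact_mod_cast hk
      linarith

/-! ### Mixed forward/backward differences in one coordinate -/

/-- Translation on `ZMod M`. [folklore] -/
def shiftM (a : ZMod M) (h : ZMod M → ℝ) : ZMod M → ℝ := fun y => h (y + a)

omit [NeZero M] in
/-- `Δ` commutes with translations. [folklore] -/
theorem fwdDiffM_shiftM (a : ZMod M) (h : ZMod M → ℝ) : fwdDiffM (shiftM a h) = shiftM a (fwdDiffM h) := by
  funext y; simp only [fwdDiffM, shiftM]; ring_nf

omit [NeZero M] in
/-- `Δ^k` commutes with translations. [folklore] -/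
theorem iter_fwdDiffM_shiftM (a : ZMod M) (k : ℕ) (h : ZMod M → ℝ) : fwdDiffM^[k] (shiftM a h) = shiftM a (fwdDiffM^[k] h) := by
  induction k generalizing h with
  | zero => rfl
  | succ k ih => rw [Function.iterate_succ_apply, Function.iterate_succ_apply, fwdDiffM_shiftM, ih]

/-- The difference in direction `±1`: `(D_b h)(y) = h(y ± 1) - h(y)`. [folklore] -/
def dirDiff (b : Bool) (h : ZMod M → ℝ) : ZMod M → ℝ := fun y => h (y + (if b then 1 else -1)) - h y

/-- Mixed differences along a list of directions (outermost first, as `fdiffs`). [folklore] -/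
def dirDiffs (l : List Bool) (h : ZMod M → ℝ) : ZMod M → ℝ := l.foldr dirDiff h

omit [NeZero M] in
/-- A backward difference is minus a shifted forward difference. [folklore] -/
theorem dirDiff_false (h : ZMod M → ℝ) : dirDiff false h = fun y => -(shiftM (-1) (fwdDiffM h) y) := by
  funext y; simp only [dirDiff, shiftM, fwdDiffM, Bool.false_eq_true, if_false]; ring_nf

omit [NeZero M] in
/-- A forward difference. [folklore] -/
theorem dirDiff_true (h : ZMod M → ℝ) : dirDiff true h = fwdDiffM h := by
  funext y; simp [dirDiff, fwdDiffM]

omit [NeZero M] in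
/-- **Mixed differences are signed, shifted pure forward differences**:
`D_l h = (-1)^{#back} τ_{-#back} Δ^{|l|} h`. [folklore] -/
theorem dirDiffs_eq (h : ZMod M → ℝ) : ∀ l : List Bool,
    dirDiffs l h = fun y => (-1 : ℝ) ^ (l.count false) * fwdDiffM^[l.length] h (y - (l.count false : ℕ))
  | [] => by funext y; simp [dirDiffs]
  | b :: l => by
      have ih := dirDiffs_eq h l
      show dirDiff b (dirDiffs l h) = _
      rw [ih]
      funext y
      cases b
      · simp only [dirDiff, Bool.false_eq_true, if_false, List.count_cons, beq_self_eq_true, if_true,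
          List.length_cons, Function.iterate_succ_apply', fwdDiffM, pow_succ]
        push_cast
        ring_nf
      · simp only [dirDiff, if_true, List.count_cons, List.length_cons, Function.iterate_succ_apply', fwdDiffM]
        simp
        ring_nf

omit [NeZero M] in
/-- **Bound for mixed differences from the forward ones.** [folklore] -/
theorem abs_dirDiffs_le {h : ZMod M → ℝ} {k : ℕ} {C : ℝ} (hC : ∀ y, |fwdDiffM^[k] h y| ≤ C) (l : List Bool)
    (hl : l.length = k) (y : ZMod M) : |dirDiffs l h y| ≤ C := by
  rw [dirDiffs_eq h l]
  simp only [abs_mul, abs_pow, abs_neg, abs_one, one_pow, one_mul, hl]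
  exact hC _

/-! ### The lifted bump -/

/-- **The bump on `ZMod M`** centred at `c`: `b(y) = bumpZ u v w K (z(y))`, `z(y) = (y - c).valMinAbs`. [folklore] -/
def bumpM (c : ZMod M) (u v : ℤ) (w K : ℕ) : ZMod M → ℝ := liftM c (bumpZ u v w K)

omit [NeZero M] in
/-- The bump vanishes near the window ends when its support is well inside. [folklore] -/
theorem vanNear_bumpZ {u v : ℤ} {w K : ℕ} {T : ℤ} (hu : 2 * (K * (w - 1 : ℕ) - u) < T) (hv : 2 * (v + K * (w - 1 : ℕ)) < T) :
    VanNear T (bumpZ u v w K) := by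
  intro t ht
  refine bumpZ_eq_zero ?_
  rcases abs_cases t with ⟨h1, _⟩ | ⟨h1, _⟩
  · right; linarith
  · left; linarith

/-- **`|D_l b| ≤ (2/w)^{|l|}` for the lifted bump**, for mixed directions `l` with `|l| ≤ K`, when the
support `[u - K(w-1), v + K(w-1)]` lies inside the window shrunk by `K`:
`2(K(w-1) - u) < M - 2K`, `2(v + K(w-1)) < M - 2K`. [folklore] -/
theorem abs_dirDiffs_bumpM_le {c : ZMod M} {u v : ℤ} {w K : ℕ} (hw : 1 ≤ w)
    (hu : 2 * (K * (w - 1 : ℕ) - u) < (M : ℤ) - 2 * K) (hv : 2 * (v + K * (w - 1 : ℕ)) < (M : ℤ) - 2 * K)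
    (l : List Bool) (hl : l.length ≤ K) (y : ZMod M) : |dirDiffs l (bumpM c u v w K) y| ≤ (2 / w) ^ l.length := by
  refine abs_dirDiffs_le (k := l.length) (fun y' => ?_) l rfl y
  unfold bumpM
  rw [iter_fwdDiffM_liftM (vanNear_bumpZ hu hv) c l.length hl]
  exact abs_iter_fwdDiff_bumpZ_le hw hl _

omit [NeZero M] in
/-- The lifted bump takes values in `[0,1]`. [folklore] -/
theorem bumpM_mem_Icc (c : ZMod M) (u v : ℤ) {w : ℕ} (K : ℕ) (hw : 1 ≤ w) (y : ZMod M) :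
    0 ≤ bumpM c u v w K y ∧ bumpM c u v w K y ≤ 1 :=
  bumpZ_mem_Icc hw _

omit [NeZero M] in
/-- The lifted bump is `1` where the centred coordinate lies in `[u, v]`. [folklore] -/
theorem bumpM_eq_one {c : ZMod M} {u v : ℤ} {w K : ℕ} (hw : 1 ≤ w) {y : ZMod M} (h1 : u ≤ (y - c).valMinAbs)
    (h2 : (y - c).valMinAbs ≤ v) : bumpM c u v w K y = 1 :=
  bumpZ_eq_one hw h1 h2

omit [NeZero M] in
/-- The lifted bump vanishes where the centred coordinate is outside `[u - K(w-1), v + K(w-1)]`. [folklore] -/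
theorem bumpM_eq_zero {c : ZMod M} {u v : ℤ} {w K : ℕ} {y : ZMod M}
    (h : (y - c).valMinAbs < u - K * (w - 1 : ℕ) ∨ v + K * (w - 1 : ℕ) < (y - c).valMinAbs) : bumpM c u v w K y = 0 :=
  bumpZ_eq_zero h

end Bump

end LongRangePhi4

end Literature.Barriers.CriticalPhenomena
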